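import Literature.NumberTheory.Automorphic.UnitaryGroupSingularBracket
import HarnessLib

/-!
# The bracket `b_T` of the singular Borel class of `U(J₃)`, II: invariance under the adelic centre `Z_N(𝔸_F)` and
# measurability
(Rogawski (1990), §7.2 Prop. 7.2.1 and (7.2.3), pp. 91–93; Arthur, Duke Math. J. 45 (1978), §8.)

Topic `NumberTheory/Automorphic`; namespace `Literature.NumberTheory.Automorphic.UnitaryGroup`. THEOREMS ONLY (no
definition, no named fact, no instance, no notation, no `sorry`). Sequel of ★ `UnitaryGroupSingularBracket` (row
(L5-iii-b2) «bracket file (iii)» of the T1-qs LAW 5 road of `Cruxes/H413/Lines/F0_T1InnerFormTraceIdentity.lean`, cell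
`pub/hodgecm-mathlib`, crux H413), SAME letters and the SAME inline bracket
`b_T(y) = Σ'_{n ∈ N_{γ₀}(F), n ≠ 1} f(y⁻¹ (n γ₀) y) − 1_{T < H(y)} · μY(𝓕⁻)⁻¹ ∫_{𝔸_E⁻} f(y⁻¹ (γ₀ n(w)) y) dμY(w)`,
`n(w) = heisElt hc 0 w`.

* `basePoint_mul_center_comm` — the base point `γ₀ = ι(d(a,b,a))` commutes with every `n(w)` (its scaling idele on the centre
  is `d₀⁻¹d₂ = a⁻¹a = 1`; ★ `UnitaryGroupSingularBracket.borel_inv_mul_center_mul_eq_heisChart_smul`).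
* **`singularBracket_center_mul`** — `b_T(n(w₀) y) = b_T(y)` for every ADELIC centre element `n(w₀)`, `w₀ ∈ 𝔸_E⁻`, whenever
  `γ₀` commutes with the centre: `n(w₀)` commutes with `N_{γ₀}(F) ⊆ N(𝔸_F)` and with each `n(w)` (★ `heisElt_zero_mul_comm`),
  and `H(n(w₀) y) = H(y)` (★ `borelHeight_unipotent_mul`) — termwise, no property of `μY` used ((b2-β) pen's extra head (Z)).
* `stronglyMeasurable_integral_center` (Mathlib `StronglyMeasurable.integral_prod_left'`) and **`measurable_singularBracket`**
  — `b_T` is Borel for continuous `f` and s-finite `μY` (countable `tsum` of continuous functions, ★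
  `measurableSet_setOf_lt_borelHeight`).

## References

* J. D. Rogawski, *Automorphic Representations of Unitary Groups in Three Variables*, Ann. of Math. Stud. 123 (1990),
  §7.2 Prop. 7.2.1, (7.2.3) (pp. 91–93) [Rogawski1990].
* J. Arthur, *A trace formula for reductive groups I*, Duke Math. J. 45 (1978), §8 [Arthur1978TraceFormulaI].
-/

set_option autoImplicit false

noncomputable section

open MeasureTheory Measure NumberField IsDedekindDomain Topology
open scoped MatrixGroups NNReal ENNReal

namespace Literature.NumberTheory.Automorphic

namespace UnitaryGroup

variable {F E : Type} [Field F] [NumberField F] [Field E] [NumberField E] [Algebra F E]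
  {c : E ≃ₐ[F] E}

/-- `G(F)` is countable (local copy of the plumbing of ★ `UnitaryGroupTruncatedKernelClassMeasurable`). [folklore] -/
private theorem countable_arithmeticSubgroup₁₉ {N : ℕ} : Countable (quasiSplit F E c N).arithmeticSubgroup := by
  rw [← quotientSubgroup_quasiSplit]; exact countable_quotientSubgroup_quasiSplit

/-- `unipToBorel u` has the same adelic point as `u` (definitional bookkeeping). [folklore] -/
private theorem coe_coe_unipToBorel₁₉ (u : adelicUnipotent F E c 3) :
    (((unipToBorel F E c u : unipotentInBorel F E c 3) : borelAdelic F E c 3) : (quasiSplit F E c 3).Adelic) = u := rfl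

/-- **The base point `γ₀ = ι(d(a,b,a))` commutes with the adelic centre**: `γ₀ n(w) = n(w) γ₀` (its scaling idele is
`d₀⁻¹d₂ = a⁻¹a = 1`) — the hypothesis `hcomm` of `singularBracket_center_mul` at the consumers' base point.
[cite: Rogawski1990, §7.2 (p. 91)] -/
theorem basePoint_mul_center_comm (hc : c * c = 1) {a b : Eˣ} {g₀ : (quasiSplit F E c 3).Rational}
    {γ₀ : (quasiSplit F E c 3).arithmeticSubgroup}
    (hg₀ : ((g₀.val : GL (Fin 3) E) : Matrix (Fin 3) (Fin 3) E) = !![(a : E), 0, 0; 0, b, 0; 0, 0, a])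
    (hγ₀ : (γ₀ : (quasiSplit F E c 3).Adelic) = (quasiSplit F E c 3).toAdelic g₀) (w : traceZeroAdele F E c) :
    (γ₀ : (quasiSplit F E c 3).Adelic) * (((heisElt hc 0 w : unipotentInBorel F E c 3) : borelAdelic F E c 3) : (quasiSplit F E c 3).Adelic) =
      (((heisElt hc 0 w : unipotentInBorel F E c 3) : borelAdelic F E c 3) : (quasiSplit F E c 3).Adelic) * (γ₀ : (quasiSplit F E c 3).Adelic) := by
  have hB : (γ₀ : (quasiSplit F E c 3).Adelic) ∈ borelAdelic F E c 3 :=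
    (mem_arithmeticBorel_iff γ₀).1 (basePoint_mem_arithmeticBorel hg₀ hγ₀)
  set β : borelAdelic F E c 3 := ⟨(γ₀ : (quasiSplit F E c 3).Adelic), hB⟩ with hβ
  -- the diagonal entries `d₀ = d₂ = a` of `γ₀`
  have hd : ∀ i : Fin 3, (diagUnit β.2 i : AdeleRing (𝓞 E) E) =
      algebraMap E (AdeleRing (𝓞 E) E) ((((g₀.val : GL (Fin 3) E) : Matrix (Fin 3) (Fin 3) E)) i i) := by
    intro i
    rw [coe_diagUnit]
    change (adelicVal F E c 3 _ (γ₀ : (quasiSplit F E c 3).Adelic) : Matrix (Fin 3) (Fin 3) (AdeleRing (𝓞 E) E)) i i = _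
    rw [hγ₀]; rfl
  have hl : ((((diagUnit β.2 0)⁻¹ * diagUnit β.2 2 : (AdeleRing (𝓞 E) E)ˣ)) : AdeleRing (𝓞 E) E) = 1 := by
    have h0 : (diagUnit β.2 0 : AdeleRing (𝓞 E) E) = diagUnit β.2 2 := by
      rw [hd 0, hd 2, hg₀]; rfl
    rw [Units.val_mul, ← h0, Units.inv_mul]
  have hconj := borel_inv_mul_center_mul_eq_heisChart_smul hc β w
  have hw : smulTraceZero ((diagUnit β.2 0)⁻¹ * diagUnit β.2 2)
      (conjAdele_torusCentralScalar
        (⟨torusPart β, (mem_torusInBorel_iff _).2 (torusPart_mem_torusAdelic β)⟩ : torusInBorel F E c 3)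
        (adelicVal_torusPart β).symm) w = w := Subtype.ext (by rw [coe_smulTraceZero, hl, one_mul])
  rw [hw] at hconj
  -- `γ₀⁻¹ n(w) γ₀ = n(w)` ⇒ `γ₀ n(w) = n(w) γ₀`
  change (β : (quasiSplit F E c 3).Adelic) * ((heisChart hc ((0 : AdeleRing (𝓞 E) E), w) : adelicUnipotent F E c 3) :
      (quasiSplit F E c 3).Adelic) = ((heisChart hc ((0 : AdeleRing (𝓞 E) E), w) : adelicUnipotent F E c 3) :
      (quasiSplit F E c 3).Adelic) * (β : (quasiSplit F E c 3).Adelic)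
  calc (β : (quasiSplit F E c 3).Adelic) * ((heisChart hc ((0 : AdeleRing (𝓞 E) E), w) : adelicUnipotent F E c 3) :
        (quasiSplit F E c 3).Adelic)
      = (β : (quasiSplit F E c 3).Adelic) * ((β : (quasiSplit F E c 3).Adelic)⁻¹ *
          ((heisChart hc ((0 : AdeleRing (𝓞 E) E), w) : adelicUnipotent F E c 3) : (quasiSplit F E c 3).Adelic) *
          (β : (quasiSplit F E c 3).Adelic)) := by rw [hconj]
    _ = _ := by group

section Center

variable [MeasurableSpace (AdeleRing (𝓞 E) E)]

set_option maxHeartbeats 400000 in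
/-- **THE BRACKET `b_T` IS LEFT `Z_N(𝔸_F)`-INVARIANT**: for every adelic centre element `n(w₀)`, `w₀ ∈ 𝔸_E⁻`, and every
`y`, `b_T(n(w₀) y) = b_T(y)`, provided `γ₀` commutes with the centre (`basePoint_mul_center_comm`): `n(w₀)` commutes with
`N_{γ₀}(F) ⊆ N(𝔸_F)` and with every `n(w)` (★ `heisElt_zero_mul_comm`), and `H(n(w₀) y) = H(y)` (★ `borelHeight_unipotent_mul`)
— so every term of `b_T` is unchanged; no property of `μY` is used. [cite: Rogawski1990, §7.2 Prop. 7.2.1, (7.2.3) (pp. 92–93)] -/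
theorem singularBracket_center_mul (hc : c * c = 1) (γ₀ : (quasiSplit F E c 3).arithmeticSubgroup)
    (hcomm : ∀ w : traceZeroAdele F E c, (γ₀ : (quasiSplit F E c 3).Adelic) * (((heisElt hc 0 w : unipotentInBorel F E c 3) : borelAdelic F E c 3) : (quasiSplit F E c 3).Adelic) =
      (((heisElt hc 0 w : unipotentInBorel F E c 3) : borelAdelic F E c 3) : (quasiSplit F E c 3).Adelic) * (γ₀ : (quasiSplit F E c 3).Adelic))
    (μY : Measure (traceZeroAdele F E c)) (T : ℝ≥0) (f : (quasiSplit F E c 3).Adelic → ℂ)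
    (w₀ : traceZeroAdele F E c) (y : (quasiSplit F E c 3).Adelic) :
    (∑' n : {n : ↥((adelicUnipotent F E c 3).subgroupOf (quasiSplit F E c 3).arithmeticSubgroup ⊓
        Subgroup.centralizer ({γ₀} : Set (quasiSplit F E c 3).arithmeticSubgroup)) // n ≠ 1},
      f (((((heisElt hc 0 w₀ : unipotentInBorel F E c 3) : borelAdelic F E c 3) : (quasiSplit F E c 3).Adelic) * y)⁻¹ * (((n.1 : (quasiSplit F E c 3).arithmeticSubgroup) * γ₀ : (quasiSplit F E c 3).arithmeticSubgroup) :
        (quasiSplit F E c 3).Adelic) * ((((heisElt hc 0 w₀ : unipotentInBorel F E c 3) : borelAdelic F E c 3) : (quasiSplit F E c 3).Adelic) * y))) -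
      Set.indicator {y : (quasiSplit F E c 3).Adelic | T < borelHeight y}
        (fun y => (μY (traceZeroFundamentalDomain F E c)).toReal⁻¹ • ∫ w : traceZeroAdele F E c,
          f (y⁻¹ * ((γ₀ : (quasiSplit F E c 3).Adelic) *
            (((heisElt hc 0 w : unipotentInBorel F E c 3) : borelAdelic F E c 3) : (quasiSplit F E c 3).Adelic)) * y) ∂μY)
        ((((heisElt hc 0 w₀ : unipotentInBorel F E c 3) : borelAdelic F E c 3) : (quasiSplit F E c 3).Adelic) * y) =
    (∑' n : {n : ↥((adelicUnipotent F E c 3).subgroupOf (quasiSplit F E c 3).arithmeticSubgroup ⊓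
        Subgroup.centralizer ({γ₀} : Set (quasiSplit F E c 3).arithmeticSubgroup)) // n ≠ 1},
      f ((y)⁻¹ * (((n.1 : (quasiSplit F E c 3).arithmeticSubgroup) * γ₀ : (quasiSplit F E c 3).arithmeticSubgroup) :
        (quasiSplit F E c 3).Adelic) * (y))) -
      Set.indicator {y : (quasiSplit F E c 3).Adelic | T < borelHeight y}
        (fun y => (μY (traceZeroFundamentalDomain F E c)).toReal⁻¹ • ∫ w : traceZeroAdele F E c,
          f (y⁻¹ * ((γ₀ : (quasiSplit F E c 3).Adelic) *
            (((heisElt hc 0 w : unipotentInBorel F E c 3) : borelAdelic F E c 3) : (quasiSplit F E c 3).Adelic)) * y) ∂μY) y := by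
  -- `n(w₀)` commutes with `N_{γ₀}(F)` and with the centre
  have hN : ∀ n : {n : ↥((adelicUnipotent F E c 3).subgroupOf (quasiSplit F E c 3).arithmeticSubgroup ⊓
        Subgroup.centralizer ({γ₀} : Set (quasiSplit F E c 3).arithmeticSubgroup)) // n ≠ 1},
      (((heisElt hc 0 w₀ : unipotentInBorel F E c 3) : borelAdelic F E c 3) : (quasiSplit F E c 3).Adelic) * (((n.1 : (quasiSplit F E c 3).arithmeticSubgroup) : (quasiSplit F E c 3).arithmeticSubgroup) :
        (quasiSplit F E c 3).Adelic) =
      (((n.1 : (quasiSplit F E c 3).arithmeticSubgroup) : (quasiSplit F E c 3).arithmeticSubgroup) :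
        (quasiSplit F E c 3).Adelic) * (((heisElt hc 0 w₀ : unipotentInBorel F E c 3) : borelAdelic F E c 3) : (quasiSplit F E c 3).Adelic) := by
    intro n
    have hmem : (((n.1 : (quasiSplit F E c 3).arithmeticSubgroup) : (quasiSplit F E c 3).arithmeticSubgroup) :
        (quasiSplit F E c 3).Adelic) ∈ adelicUnipotent F E c 3 :=
      Subgroup.mem_subgroupOf.1 (Subgroup.mem_inf.1 n.1.2).1
    have h := congrArg (fun u : unipotentInBorel F E c 3 => ((u : borelAdelic F E c 3) : (quasiSplit F E c 3).Adelic))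
      (heisElt_zero_mul_comm hc w₀ (unipToBorel F E c ⟨_, hmem⟩))
    simp only [Subgroup.coe_mul, coe_coe_unipToBorel₁₉] at h
    exact h
  have hZ : ∀ w : traceZeroAdele F E c, (((heisElt hc 0 w₀ : unipotentInBorel F E c 3) : borelAdelic F E c 3) : (quasiSplit F E c 3).Adelic) * (((heisElt hc 0 w : unipotentInBorel F E c 3) : borelAdelic F E c 3) : (quasiSplit F E c 3).Adelic) = (((heisElt hc 0 w : unipotentInBorel F E c 3) : borelAdelic F E c 3) : (quasiSplit F E c 3).Adelic) * (((heisElt hc 0 w₀ : unipotentInBorel F E c 3) : borelAdelic F E c 3) : (quasiSplit F E c 3).Adelic) := by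
    intro w
    have h := congrArg (fun u : unipotentInBorel F E c 3 => ((u : borelAdelic F E c 3) : (quasiSplit F E c 3).Adelic))
      (heisElt_zero_mul_comm hc w₀ (heisElt hc 0 w))
    simpa only [Subgroup.coe_mul] using h
  have hu : (((heisElt hc 0 w₀ : unipotentInBorel F E c 3) : borelAdelic F E c 3) : (quasiSplit F E c 3).Adelic) ∈ adelicUnipotent F E c 3 := (heisChart hc ((0 : AdeleRing (𝓞 E) E), w₀)).2
  congr 1
  · refine tsum_congr fun n => congrArg f ?_
    -- `(n γ₀) n(w₀) = n(w₀) (n γ₀)`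
    have h1 : (((n.1 : (quasiSplit F E c 3).arithmeticSubgroup) : (quasiSplit F E c 3).arithmeticSubgroup) :
        (quasiSplit F E c 3).Adelic) * (γ₀ : (quasiSplit F E c 3).Adelic) * (((heisElt hc 0 w₀ : unipotentInBorel F E c 3) : borelAdelic F E c 3) : (quasiSplit F E c 3).Adelic) =
        (((heisElt hc 0 w₀ : unipotentInBorel F E c 3) : borelAdelic F E c 3) : (quasiSplit F E c 3).Adelic) * ((((n.1 : (quasiSplit F E c 3).arithmeticSubgroup) : (quasiSplit F E c 3).arithmeticSubgroup) :
        (quasiSplit F E c 3).Adelic) * (γ₀ : (quasiSplit F E c 3).Adelic)) := by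
      rw [mul_assoc, hcomm w₀, ← mul_assoc, ← hN n, mul_assoc]
    rw [Subgroup.coe_mul, _root_.mul_inv_rev]
    calc y⁻¹ * ((((heisElt hc 0 w₀ : unipotentInBorel F E c 3) : borelAdelic F E c 3) : (quasiSplit F E c 3).Adelic))⁻¹ * ((((n.1 : (quasiSplit F E c 3).arithmeticSubgroup) : (quasiSplit F E c 3).arithmeticSubgroup) :
        (quasiSplit F E c 3).Adelic) * (γ₀ : (quasiSplit F E c 3).Adelic)) * ((((heisElt hc 0 w₀ : unipotentInBorel F E c 3) : borelAdelic F E c 3) : (quasiSplit F E c 3).Adelic) * y)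
        = y⁻¹ * (((((heisElt hc 0 w₀ : unipotentInBorel F E c 3) : borelAdelic F E c 3) : (quasiSplit F E c 3).Adelic))⁻¹ * ((((n.1 : (quasiSplit F E c 3).arithmeticSubgroup) : (quasiSplit F E c 3).arithmeticSubgroup) :
        (quasiSplit F E c 3).Adelic) * (γ₀ : (quasiSplit F E c 3).Adelic) * (((heisElt hc 0 w₀ : unipotentInBorel F E c 3) : borelAdelic F E c 3) : (quasiSplit F E c 3).Adelic))) * y := by
          simp only [mul_assoc]
      _ = y⁻¹ * (((((heisElt hc 0 w₀ : unipotentInBorel F E c 3) : borelAdelic F E c 3) : (quasiSplit F E c 3).Adelic))⁻¹ * ((((heisElt hc 0 w₀ : unipotentInBorel F E c 3) : borelAdelic F E c 3) : (quasiSplit F E c 3).Adelic) * ((((n.1 : (quasiSplit F E c 3).arithmeticSubgroup) : (quasiSplit F E c 3).arithmeticSubgroup) :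
        (quasiSplit F E c 3).Adelic) * (γ₀ : (quasiSplit F E c 3).Adelic)))) * y := by rw [h1]
      _ = _ := by rw [inv_mul_cancel_left]
  · have hH : borelHeight ((((heisElt hc 0 w₀ : unipotentInBorel F E c 3) : borelAdelic F E c 3) : (quasiSplit F E c 3).Adelic) * y) = borelHeight y := borelHeight_unipotent_mul hu y
    by_cases hy : T < borelHeight y
    · have hy' : (((heisElt hc 0 w₀ : unipotentInBorel F E c 3) : borelAdelic F E c 3) : (quasiSplit F E c 3).Adelic) * y ∈ {y : (quasiSplit F E c 3).Adelic | T < borelHeight y} := by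
        change T < borelHeight ((((heisElt hc 0 w₀ : unipotentInBorel F E c 3) : borelAdelic F E c 3) : (quasiSplit F E c 3).Adelic) * y); rw [hH]; exact hy
      rw [Set.indicator_of_mem hy', Set.indicator_of_mem (show y ∈ {y : (quasiSplit F E c 3).Adelic | T < borelHeight y} from hy)]
      -- `(γ₀ n(w)) n(w₀) = n(w₀) (γ₀ n(w))`, termwise under the integral
      have h2 : ∀ w : traceZeroAdele F E c,
          (γ₀ : (quasiSplit F E c 3).Adelic) * (((heisElt hc 0 w : unipotentInBorel F E c 3) : borelAdelic F E c 3) : (quasiSplit F E c 3).Adelic) * (((heisElt hc 0 w₀ : unipotentInBorel F E c 3) : borelAdelic F E c 3) : (quasiSplit F E c 3).Adelic) = (((heisElt hc 0 w₀ : unipotentInBorel F E c 3) : borelAdelic F E c 3) : (quasiSplit F E c 3).Adelic) * ((γ₀ : (quasiSplit F E c 3).Adelic) * (((heisElt hc 0 w : unipotentInBorel F E c 3) : borelAdelic F E c 3) : (quasiSplit F E c 3).Adelic)) := by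
        intro w
        rw [mul_assoc, ← hZ w, ← mul_assoc, hcomm w₀, mul_assoc]
      have hfun : (fun w : traceZeroAdele F E c => f (((((heisElt hc 0 w₀ : unipotentInBorel F E c 3) : borelAdelic F E c 3) : (quasiSplit F E c 3).Adelic) * y)⁻¹ *
            ((γ₀ : (quasiSplit F E c 3).Adelic) * (((heisElt hc 0 w : unipotentInBorel F E c 3) : borelAdelic F E c 3) : (quasiSplit F E c 3).Adelic)) * ((((heisElt hc 0 w₀ : unipotentInBorel F E c 3) : borelAdelic F E c 3) : (quasiSplit F E c 3).Adelic) * y))) =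
          fun w : traceZeroAdele F E c => f (y⁻¹ * ((γ₀ : (quasiSplit F E c 3).Adelic) * (((heisElt hc 0 w : unipotentInBorel F E c 3) : borelAdelic F E c 3) : (quasiSplit F E c 3).Adelic)) * y) := by
        funext w
        refine congrArg f ?_
        rw [_root_.mul_inv_rev]
        calc y⁻¹ * ((((heisElt hc 0 w₀ : unipotentInBorel F E c 3) : borelAdelic F E c 3) : (quasiSplit F E c 3).Adelic))⁻¹ * ((γ₀ : (quasiSplit F E c 3).Adelic) * (((heisElt hc 0 w : unipotentInBorel F E c 3) : borelAdelic F E c 3) : (quasiSplit F E c 3).Adelic)) * ((((heisElt hc 0 w₀ : unipotentInBorel F E c 3) : borelAdelic F E c 3) : (quasiSplit F E c 3).Adelic) * y)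
            = y⁻¹ * (((((heisElt hc 0 w₀ : unipotentInBorel F E c 3) : borelAdelic F E c 3) : (quasiSplit F E c 3).Adelic))⁻¹ * ((γ₀ : (quasiSplit F E c 3).Adelic) * (((heisElt hc 0 w : unipotentInBorel F E c 3) : borelAdelic F E c 3) : (quasiSplit F E c 3).Adelic) * (((heisElt hc 0 w₀ : unipotentInBorel F E c 3) : borelAdelic F E c 3) : (quasiSplit F E c 3).Adelic))) * y := by
              simp only [mul_assoc]
          _ = y⁻¹ * (((((heisElt hc 0 w₀ : unipotentInBorel F E c 3) : borelAdelic F E c 3) : (quasiSplit F E c 3).Adelic))⁻¹ * ((((heisElt hc 0 w₀ : unipotentInBorel F E c 3) : borelAdelic F E c 3) : (quasiSplit F E c 3).Adelic) * ((γ₀ : (quasiSplit F E c 3).Adelic) * (((heisElt hc 0 w : unipotentInBorel F E c 3) : borelAdelic F E c 3) : (quasiSplit F E c 3).Adelic)))) * y := by rw [h2 w]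
          _ = _ := by rw [inv_mul_cancel_left]
      rw [hfun]
    · have hy' : (((heisElt hc 0 w₀ : unipotentInBorel F E c 3) : borelAdelic F E c 3) : (quasiSplit F E c 3).Adelic) * y ∉ {y : (quasiSplit F E c 3).Adelic | T < borelHeight y} := by
        change ¬ T < borelHeight ((((heisElt hc 0 w₀ : unipotentInBorel F E c 3) : borelAdelic F E c 3) : (quasiSplit F E c 3).Adelic) * y); rw [hH]; exact hy
      rw [Set.indicator_of_notMem hy', Set.indicator_of_notMem (show y ∉ {y : (quasiSplit F E c 3).Adelic | T < borelHeight y} from hy)]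

variable [BorelSpace (AdeleRing (𝓞 E) E)]
  [MeasurableSpace (quasiSplit F E c 3).Adelic] [BorelSpace (quasiSplit F E c 3).Adelic]

/-- **The centre integral `y ↦ ∫_{𝔸_E⁻} f(y⁻¹ (γ₀ n(w)) y) dμY(w)` is strongly measurable** for continuous `f` and s-finite
`μY` (a parametric Bochner integral of the jointly continuous integrand, Mathlib `StronglyMeasurable.integral_prod_left'`).
[cite: Rogawski1990, §7.2 (7.2.3) p. 93] -/
theorem stronglyMeasurable_integral_center (hc : c * c = 1) (γ₀ : (quasiSplit F E c 3).arithmeticSubgroup)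
    (μY : Measure (traceZeroAdele F E c)) [SFinite μY]
    {f : (quasiSplit F E c 3).Adelic → ℂ} (hfc : Continuous f) :
    StronglyMeasurable fun y : (quasiSplit F E c 3).Adelic => ∫ w : traceZeroAdele F E c,
      f (y⁻¹ * ((γ₀ : (quasiSplit F E c 3).Adelic) * (((heisElt hc 0 w : unipotentInBorel F E c 3) : borelAdelic F E c 3) : (quasiSplit F E c 3).Adelic)) * y) ∂μY := by
  haveI := secondCountableTopology_adeleRing E
  haveI : SecondCountableTopology (quasiSplit F E c 3).Adelic :=
    inferInstanceAs (SecondCountableTopology (adelic F E c 3 ((StdForm.antidiagonal 3).over E)))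
  haveI : SecondCountableTopology (traceZeroAdele F E c) := TopologicalSpace.Subtype.secondCountableTopology _
  have hcen : Continuous fun w : traceZeroAdele F E c => (((heisElt hc 0 w : unipotentInBorel F E c 3) : borelAdelic F E c 3) : (quasiSplit F E c 3).Adelic) := by
    change Continuous fun w : traceZeroAdele F E c => ((heisChart hc ((0 : AdeleRing (𝓞 E) E), w) : adelicUnipotent F E c 3) : (quasiSplit F E c 3).Adelic)
    exact continuous_subtype_val.comp ((heisChart hc).continuous.comp (continuous_const.prodMk continuous_id))
  have hF : StronglyMeasurable (fun q : traceZeroAdele F E c × (quasiSplit F E c 3).Adelic =>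
      f (q.2⁻¹ * ((γ₀ : (quasiSplit F E c 3).Adelic) *
        (((heisElt hc 0 q.1 : unipotentInBorel F E c 3) : borelAdelic F E c 3) : (quasiSplit F E c 3).Adelic)) * q.2)) := by
    refine (hfc.comp ?_).measurable.stronglyMeasurable
    exact ((continuous_snd.inv).mul (continuous_const.mul (hcen.comp continuous_fst))).mul continuous_snd
  exact MeasureTheory.StronglyMeasurable.integral_prod_left' (μ := μY) hF

/-- **THE BRACKET `b_T` IS BOREL** on `G(𝔸_F)` for continuous `f` and s-finite `μY`: a countable `tsum` of continuous
functions (`G(F)` is countable) minus the indicator of the open set `{T < H}` (★ `measurableSet_setOf_lt_borelHeight`) times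
the strongly measurable normalised centre integral. [cite: Rogawski1990, §7.2 Prop. 7.2.1, (7.2.3) (pp. 92–93)] -/
theorem measurable_singularBracket (hc : c * c = 1) (γ₀ : (quasiSplit F E c 3).arithmeticSubgroup)
    (μY : Measure (traceZeroAdele F E c)) [SFinite μY] (T : ℝ≥0)
    {f : (quasiSplit F E c 3).Adelic → ℂ} (hfc : Continuous f) :
    Measurable fun y : (quasiSplit F E c 3).Adelic =>
      (∑' n : {n : ↥((adelicUnipotent F E c 3).subgroupOf (quasiSplit F E c 3).arithmeticSubgroup ⊓
        Subgroup.centralizer ({γ₀} : Set (quasiSplit F E c 3).arithmeticSubgroup)) // n ≠ 1},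
      f ((y)⁻¹ * (((n.1 : (quasiSplit F E c 3).arithmeticSubgroup) * γ₀ : (quasiSplit F E c 3).arithmeticSubgroup) :
        (quasiSplit F E c 3).Adelic) * (y))) -
      Set.indicator {y : (quasiSplit F E c 3).Adelic | T < borelHeight y}
        (fun y => (μY (traceZeroFundamentalDomain F E c)).toReal⁻¹ • ∫ w : traceZeroAdele F E c,
          f (y⁻¹ * ((γ₀ : (quasiSplit F E c 3).Adelic) *
            (((heisElt hc 0 w : unipotentInBorel F E c 3) : borelAdelic F E c 3) : (quasiSplit F E c 3).Adelic)) * y) ∂μY) y := by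
  haveI : Countable (quasiSplit F E c 3).arithmeticSubgroup := countable_arithmeticSubgroup₁₉
  haveI : Countable ↥((adelicUnipotent F E c 3).subgroupOf (quasiSplit F E c 3).arithmeticSubgroup ⊓
      Subgroup.centralizer ({γ₀} : Set (quasiSplit F E c 3).arithmeticSubgroup)) := Subtype.countable
  haveI : Countable {n : ↥((adelicUnipotent F E c 3).subgroupOf (quasiSplit F E c 3).arithmeticSubgroup ⊓
        Subgroup.centralizer ({γ₀} : Set (quasiSplit F E c 3).arithmeticSubgroup)) // n ≠ 1} := Subtype.countable
  refine (Measurable.tsum fun n => ?_).sub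
    (((stronglyMeasurable_integral_center hc γ₀ μY hfc).measurable.const_smul
      ((μY (traceZeroFundamentalDomain F E c)).toReal⁻¹)).indicator (measurableSet_setOf_lt_borelHeight T))
  exact (hfc.comp ((continuous_id.inv.mul continuous_const).mul continuous_id)).measurable

end Center

end UnitaryGroup

end Literature.NumberTheory.Automorphic

end
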